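import Mathlib
import HarnessLib
import Summits.Langlands.Langlands.Theses.NonParallelVoid
import Summits.Langlands.Langlands.Theorems.TriangulineChamberLiftB2CrysSplitPCompletion
import Summits.Langlands.Langlands.Theorems.NonParallelVoidEmptyWeightCoreStubSplitPrime
import Summits.Langlands.Langlands.Theorems.NonParallelVoidEmptyWeightCoreStubResidualDet
import Summits.Langlands.Langlands.Theorems.NonParallelVoidEmptyWeightCoreStubInertiaTransport
import Summits.Langlands.Langlands.Theorems.NonParallelVoidEmptyWeightCoreStubCyclotomicOuterConj
import Summits.Langlands.Langlands.Theorems.NonParallelVoidEmptyWeightCoreStubCyclotomicResidue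
import Summits.Langlands.Langlands.Theorems.NonParallelVoidEmptyWeightCoreStubSquareParityCore
import Summits.Langlands.Langlands.Theorems.NonParallelVoidEmptyWeightCoreStubModPCyclotomicOnInertia
import Summits.Langlands.Langlands.Theorems.NonParallelVoidEmptyWeightCoreStubWildInertiaSquare
import Summits.Langlands.Langlands.Theorems.NonParallelVoidEmptyWeightCorePinnedCrystallineDetLocalOfFDE
import Literature.NumberTheory.GaloisRepresentations.LocalGaloisGroup
import Literature.NumberTheory.GaloisRepresentations.LocalGaloisGroupFrobeniusProofs
import Literature.NumberTheory.GaloisRepresentations.WildInertia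
import Literature.NumberTheory.GaloisRepresentations.AbsGaloisOuterConj
import Literature.NumberTheory.GaloisRepresentations.ModPGaloisRep
import Literature.NumberTheory.GaloisRepresentations.ModPGaloisRepCyclotomicProofs
import Literature.NumberTheory.GaloisRepresentations.CalegariEvenFontaineMazurTwo
import Literature.NumberTheory.GaloisRepresentations.LocalKroneckerWeberInertiaProofs
import Literature.NumberTheory.Automorphic.AdicCompletionResidueCard
import Literature.NumberTheory.PAdicHodge.FontaineDpst

/-!
# `NonParallelVoid.EmptyWeightCore` (crux stmt-Langlands-17008) — proved under `FontaineDatumExists`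

Line `local_clause_cut` of the crux (idea `det-parity-empties-core`; lines `birth`, `local_clause_cut`),
ASSEMBLED.  The crux's regime — `p ≥ 11` SPLIT in the quadratic field `F`, `ρ` CRYSTALLINE at the places
above `p` for the pinned Fontaine datum, `ρ̄` of BASE-CHANGE TYPE (trace/det transport under an outer
`τ ∈ Γ_ℚ ∖ res Γ_F` by an abstract character `χ`), and ODD gap sum `(b - a) + (b' - a')` — is EMPTY:

* S1 (`hLoc`; the registered stub `stub_pinnedCrystallineDetLocal`): `det ρ|I_{F_u} = ε^{-(a_u+b_u)}` at each
  `u ∣ p` — clause (F12) of the pin at a degree-one completion; TRUE for Fontaine's datum, proved UNDER the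
  T0 named fact `FontaineDatumExists` (`stub_pinnedCrystallineDetLocal_of_fontaineDatumExists`), NOT
  provable without it (the Weil–Deligne half of `fontainePst` is Hilbert's `ε`);
* one place (`v = w`): `ℚ_p → F_v` is onto at a split prime (`stub_splitPrime`,
  `algHom_adicCompletion_subsingleton_of_split`), so the two labels coincide and the gaps are equal;
* two places (`v ≠ w`): `θ_τ` carries `res_w(I_{F_w})` into a conjugate of `res_v(I_{F_v})`
  (`stub_inertiaTransport`), `ε_F` is `θ_τ`-invariant (`stub_cyclotomicOuterConj`), determinants reduce
  (`stub_residualDet`, `stub_cyclotomicResidue`, `toZMod_cyclotomicCharacter_apply`), so the det clause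
  reads `χ(res_w σ)² = ω̄(σ)^{(a'+b')-(a+b)}` on `I_{F_w}`, and the LOCAL PARITY LEMMA
  (`localSquareParity`: Frobenius on tame inertia `conj_mul_pow_inv_mem_absWildInertia`, wild inertia
  2-divisible `stub_wildInertiaSquare`, `ω̄|I = ψ₁` onto `𝔽_pˣ` and trivial on `P`
  `stub_modPCyclotomicOnInertia`, algebra `stub_squareParityCore`) makes the gap sum even —
  contradicting the crux's odd-gap-sum hypothesis, whence the conclusion by `(hnE _).elim`.

Deciding theorem: `Summit.Langlands.Langlands.Theorems.EmptyWeightCore_of_fontaineDatumExists :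
FontaineDatumExists → NonParallelVoid.EmptyWeightCore` — CONDITIONAL on the existing named fact
`Literature.NumberTheory.PAdicHodge.FontaineDatumExists` (cone tier T0; its discharge
`FontaineDatumExists_holds` is the construction of `D_pst`, definition item D2 of `FontaineDpst`), and
`emptyWeightCore_of_pinnedCrystallineDetLocal : S1 → EmptyWeightCore` unconditionally.
Axioms: `propext`, `Classical.choice`, `Quot.sound`.  No `sorry`, no new definition.
-/

-- project-wide option (lakefile weak.linter.dupNamespace); `Summit.Langlands.Langlands` is mandated
set_option linter.dupNamespace false

noncomputable section

namespace Summit.Langlands.Langlands.Theorems.NonParallelVoidEmptyWeightCore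

open Summit.Langlands.Langlands.Theses.NonParallelVoid
open Summit.Langlands.Langlands.Cruxes.EmptyWeightCore.LocalClauseCut
open Literature.NumberTheory.GaloisRepresentations Literature.NumberTheory.PAdicHodge
open Field IsDedekindDomain NumberField ValuativeRel
open Literature.NumberTheory.GaloisRepresentations.IsNonarchimedeanLocalField (residueFieldCard)

/-- **The local parity lemma** (from the landed stubs `stub_wildInertiaSquare`,
`stub_modPCyclotomicOnInertia`, `stub_squareParityCore`):
`K/ℚ_p` with `e = f = 1`, `p` odd, `χ : Γ_K →* kˣ` an abstract character with `χ² = ι(ω̄)ⁿ` on `I_K`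
⇒ `n` even.  The Frobenius input is the tree's `conj_mul_pow_inv_mem_absWildInertia` (Serre:
`s u s⁻¹ ≡ u^q (mod P)`) at an arithmetic Frobenius (`exists_isFrobPow_holds`).
[cite: SerreInventiones1972, §1.8 Prop. 6] -/
theorem localSquareParity :
    ∀ (K : Type) [Field K] [ValuativeRel K] [TopologicalSpace K] [IsNonarchimedeanLocalField K]
      [CharZero K] (p : ℕ) [Fact p.Prime], p ≠ 2 →
      residueFieldCard K = p → Irreducible ((p : ℕ) : 𝒪[K]) →
      ∀ (k : Type) [Field k] (ι : ZMod p →+* k) (χ : absoluteGaloisGroup K →* kˣ) (n : ℤ),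
        (∀ σ ∈ absInertia K,
            ((χ σ : kˣ) : k) ^ 2 = ι ((modPCyclotomicCharacterZMod K p σ : (ZMod p)ˣ) : ZMod p) ^ n) →
        Even n := by
  have h1 := @stub_wildInertiaSquare
  have h2 := @stub_modPCyclotomicOnInertia
  have h3 := @stub_squareParityCore
  intro K _ _ _ _ _ p _ hp2 hq hirr k _ ι χ n hχ
  -- residue characteristic of `K` is `p`
  have hchar : ringChar 𝓀[K] = p := by
    obtain ⟨f, -, hf⟩ := IsNonarchimedeanLocalField.residueFieldCard_eq_pow_ringChar K
    rw [hq] at hf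
    exact ((Fact.out : p.Prime).pow_eq_iff.1 hf.symm).1
  -- an arithmetic Frobenius
  obtain ⟨φ, hφ⟩ := exists_isFrobPow_holds (F := K) ((1 : ℕ) : ℤ)
  obtain ⟨hω1, σ₀, hσ₀, hprim⟩ := h2 K p hq hirr
  refine h3 (absoluteGaloisGroup K) (absInertia K) (absWildInertia K ((p : ℕ) : 𝒪[K])) φ p hp2
    (absWildInertia_le_absInertia (F := K) _) (h1 K ((p : ℕ) : 𝒪[K]) hirr (by rw [hchar]; exact hp2)) ?_
    (modPCyclotomicCharacterZMod K p) hω1 ⟨σ₀, hσ₀, hprim⟩ k ι χ n hχ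
  intro σ hσ
  have h := conj_mul_pow_inv_mem_absWildInertia hirr.ne_zero hφ hσ
  rwa [pow_one, hq] at h


/-- If `-(a + b) - -(a' + b')` is even then the gap sum `(b - a) + (b' - a')` is even. [folklore] -/
theorem gapSum_even_of_detExponents_even {a b a' b' : ℤ} (h : Even (-(a + b) - -(a' + b'))) :
    Even (b - a + (b' - a')) := by
  obtain ⟨r, hr⟩ := h
  exact ⟨r + b - a', by omega⟩

/-- Two increasing pairs with the same underlying multiset are equal. [folklore] -/
theorem pair_eq_of_lt {a b a' b' : ℤ} (h : ({a, b} : Multiset ℤ) = {a', b'}) (hlt : a < b)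
    (hlt' : a' < b') : a = a' ∧ b = b' := by
  have ha : a ∈ ({a', b'} : Multiset ℤ) := h ▸ Multiset.mem_cons_self a _
  have hb : b ∈ ({a', b'} : Multiset ℤ) := h ▸ (Multiset.mem_cons.2 (Or.inr (Multiset.mem_singleton_self b)))
  simp only [Multiset.insert_eq_cons, Multiset.mem_cons, Multiset.mem_singleton] at ha hb
  omega

/-- The determinant of a representation is invariant under conjugation in the group. [folklore] -/
theorem det_conj_eq {G : Type*} [Group G] [TopologicalSpace G] {R : Type*} [CommRing R]
    [TopologicalSpace R] {n : ℕ} (ρ : G →ₜ* GL (Fin n) R) (g x : G) :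
    (ρ (g⁻¹ * x * g)).val.det = (ρ x).val.det := by
  have h : Matrix.GeneralLinearGroup.det (ρ (g⁻¹ * x * g)) = Matrix.GeneralLinearGroup.det (ρ x) := by
    simp only [map_mul, map_inv]
    exact inv_mul_cancel_comm _ _
  have h' := congrArg Units.val h
  rwa [Matrix.GeneralLinearGroup.val_det_apply, Matrix.GeneralLinearGroup.val_det_apply] at h'



/-- **`EmptyWeightCore` from the local inertial determinant (S1).**  If for the pinned datum of every
place `v ∣ p` of a quadratic field with `p` split a crystalline `ρ_v` with labelled weights `{a, b}` has
`det ρ_v = ε^{-(a+b)}` on `I_{F_v}` (the registered stub `stub_pinnedCrystallineDetLocal` of line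
`local_clause_cut`, spelled out as the hypothesis `hLoc`), then the crux `EmptyWeightCore` holds: its
regime (odd gap sum, base-change-type residue, crystalline at an odd split prime) is EMPTY by
determinant parity — at one place the unique label forces equal gaps, at two places base change
transports the inertial determinant up to the square of a character and the local parity lemma makes
`(a+b) - (a'+b')` even. [folklore] -/
theorem emptyWeightCore_of_pinnedCrystallineDetLocal
    (hLoc : ∀ (F : Type) [Field F] [NumberField F] [Algebra.IsQuadraticExtension ℚ F] (p : ℕ) [Fact p.Prime]
      (ρ : Literature.NumberTheory.GaloisRepresentations.FramedGaloisRep F (PadicAlgCl p) 2),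
      (∃ v w : IsDedekindDomain.HeightOneSpectrum (NumberField.RingOfIntegers F), v ≠ w ∧
          ((p : ℕ) : NumberField.RingOfIntegers F) ∈ v.asIdeal ∧
          ((p : ℕ) : NumberField.RingOfIntegers F) ∈ w.asIdeal) →
      ∀ (v : IsDedekindDomain.HeightOneSpectrum (NumberField.RingOfIntegers F))
        (hv : ((p : ℕ) : NumberField.RingOfIntegers F) ∈ v.asIdeal),
        (Literature.NumberTheory.PAdicHodge.fontainePstAdicCompletion v p hv).IsCrystallineFramed
            (ρ.toLocal v) →
        letI := (Literature.NumberTheory.PAdicHodge.fontainePstAdicCompletion v p hv).algebra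
        ∀ (τ : v.adicCompletion F →ₐ[ℚ_[p]] PadicAlgCl p) (a b : ℤ),
          ρ.labelledHodgeTateWeightsAt v
              (Literature.NumberTheory.PAdicHodge.fontainePstAdicCompletion v p hv).algebra
              (Literature.NumberTheory.PAdicHodge.fontainePstAdicCompletion v p hv).𝔅 τ.toRingHom =
            {a, b} →
          ∀ σ ∈ Literature.NumberTheory.GaloisRepresentations.absInertia (v.adicCompletion F),
            ((ρ.toLocal v) σ).val.det =
              algebraMap ℚ_[p] (PadicAlgCl p)
                ((((Literature.NumberTheory.GaloisRepresentations.GaloisRep.cyclotomicCharacter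
                      (v.adicCompletion F) p σ : ℤ_[p]ˣ) : ℤ_[p]) : ℚ_[p]) ^ (-(a + b)))) :
    Summit.Langlands.Langlands.Theses.NonParallelVoid.EmptyWeightCore := by
  have hSpl := @stub_splitPrime
  have hRes := @stub_residualDet
  have hTra := @stub_inertiaTransport
  have hCyc := @stub_cyclotomicOuterConj
  have hRed := @stub_cyclotomicResidue
  have hPar := @localSquareParity
  intro F _ _ _ hF p _ ρ hirr hunr hHT hLR hG hnE hBC
  obtain ⟨hp11, hsplit, hcrys, _hresirr⟩ := hG
  refine (hnE ?_).elim
  intro v hv w hw τ σ a b a' b' hab hlt hab' hlt'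
  have hSv := hSpl F p hsplit v hv
  have hSw := hSpl F p hsplit w hw
  by_cases hvw : v = w
  · -- ONE place: at a split prime `ℚ_p → F_v` is onto, so the two labels coincide
    subst hvw
    have hsub : @Subsingleton (letI := (fontainePstAdicCompletion v p hv).algebra;
        v.adicCompletion F →ₐ[ℚ_[p]] PadicAlgCl p) := by
      rw [fontainePstAdicCompletion_algebra_eq_adicCompletionPadicAlgebra v p hv]
      exact Summit.Langlands.Langlands.Theorems.LiftB2CrysSplitP.algHom_adicCompletion_subsingleton_of_split
        v p hv hSv.1 hSv.2.1 _
    have hτσ : τ = σ := Subsingleton.elim _ _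
    subst hτσ
    rw [hab] at hab'
    obtain ⟨rfl, rfl⟩ := pair_eq_of_lt hab' hlt hlt'
    exact ⟨b - a, by ring⟩
  · -- TWO places: transport through the base-change datum and conclude by the local parity lemma
    obtain ⟨τ₀, hτ₀, χ, hχ⟩ := hBC
    haveI : IsGalois ℚ F := Algebra.IsQuadraticExtension.isGalois ℚ F
    obtain ⟨g, hg⟩ := hTra F p τ₀ hτ₀ v w hvw hv hw
    -- S1 at `v` (label `τ`, weights `{a, b}`) and at `w` (label `σ`, weights `{a', b'}`)
    have hv₁ := hLoc F p ρ hsplit v hv (hcrys v hv) τ a b hab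
    have hw₁ := hLoc F p ρ hsplit w hw (hcrys w hw) σ a' b' hab'
    haveI hcw : CharZero (w.adicCompletion F) := LocalField.charZero_adicCompletion w
    have hqw : residueFieldCard (w.adicCompletion F) = p := by
      rw [Literature.NumberTheory.Automorphic.residueFieldCard_adicCompletion_eq]; exact hSw.1
    have key : Even (-(a + b) - -(a' + b')) := by
      refine hPar (w.adicCompletion F) p (by omega) hqw hSw.2.2 (padicAlgClResidueField p)
        (zmodToPadicAlgClResidueField p)
        (χ.comp (absGaloisRestrict F (w.adicCompletion F)).toMonoidHom) _ ?_
      intro s hs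
      obtain ⟨s', hs', hres⟩ := hg s hs
      -- the cyclotomic character of `F_v` at `s'` is that of `F_w` at `s`
      have hεv : GaloisRep.cyclotomicCharacter (v.adicCompletion F) p s' =
          GaloisRep.cyclotomicCharacter (w.adicCompletion F) p s := by
        rw [← cyclotomicCharacter_absGaloisRestrict F (v.adicCompletion F) p s', hres, hCyc F p τ₀ g,
          cyclotomicCharacter_absGaloisRestrict F (w.adicCompletion F) p s]
      -- the two determinants in `ℚ̄_p`
      have h1 : (ρ (absGaloisRestrict F (w.adicCompletion F) s)).val.det =
          algebraMap ℚ_[p] (PadicAlgCl p)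
            ((((GaloisRep.cyclotomicCharacter (w.adicCompletion F) p s : ℤ_[p]ˣ) : ℤ_[p]) : ℚ_[p]) ^
              (-(a' + b'))) := hw₁ s hs
      have h2 : (ρ (absGaloisOuterConj ℚ F τ₀ (absGaloisRestrict F (w.adicCompletion F) s))).val.det =
          algebraMap ℚ_[p] (PadicAlgCl p)
            ((((GaloisRep.cyclotomicCharacter (w.adicCompletion F) p s : ℤ_[p]ˣ) : ℤ_[p]) : ℚ_[p]) ^
              (-(a + b))) := by
        have h2' : ((ρ.toLocal v) s').val.det = _ := hv₁ s' hs'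
        rw [hεv, FramedGaloisRep.toLocal_apply, hres, det_conj_eq] at h2'
        exact h2'
      -- their reductions
      obtain ⟨x₁, hx₁, hr₁⟩ := hRed p (GaloisRep.cyclotomicCharacter (w.adicCompletion F) p s) (-(a' + b'))
      obtain ⟨x₂, hx₂, hr₂⟩ := hRed p (GaloisRep.cyclotomicCharacter (w.adicCompletion F) p s) (-(a + b))
      have hd₁ := hRes F p ρ _ x₁ (by rw [hx₁, h1])
      have hd₂ := hRes F p ρ _ x₂ (by rw [hx₂, h2])
      -- the determinant clause of base-change type at `(res_w s, θ_τ (res_w s))`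
      have hcl := (hχ (absGaloisRestrict F (w.adicCompletion F) s)
        (absGaloisOuterConj ℚ F τ₀ (absGaloisRestrict F (w.adicCompletion F) s))
        (absGaloisRestrict_absGaloisOuterConj ℚ F τ₀ _)).2
      rw [hd₁, hd₂, hr₁, hr₂] at hcl
      -- `ε(s) mod p = ω̄(s)`
      have hζ : zmodToPadicAlgClResidueField p
            (PadicInt.toZMod ((GaloisRep.cyclotomicCharacter (w.adicCompletion F) p s : ℤ_[p]ˣ) : ℤ_[p])) =
          zmodToPadicAlgClResidueField p
            ((modPCyclotomicCharacterZMod (w.adicCompletion F) p s : (ZMod p)ˣ) : ZMod p) := by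
        rw [toZMod_cyclotomicCharacter_apply]
      have hζ0 : zmodToPadicAlgClResidueField p
          ((modPCyclotomicCharacterZMod (w.adicCompletion F) p s : (ZMod p)ˣ) : ZMod p) ≠ 0 :=
        (map_ne_zero _).2 (Units.ne_zero _)
      rw [hζ] at hcl
      rw [zpow_sub₀ hζ0, hcl, MonoidHom.comp_apply, mul_div_assoc, div_self (zpow_ne_zero _ hζ0),
        mul_one]
      rfl
    exact gapSum_even_of_detExponents_even key


end Summit.Langlands.Langlands.Theorems.NonParallelVoidEmptyWeightCore

namespace Summit.Langlands.Langlands.Theorems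

open Literature.NumberTheory.PAdicHodge

/-- **Crux `NonParallelVoid.EmptyWeightCore` (stmt-Langlands-17008), under Fontaine's existence theorem.**
Under the T0 named fact `FontaineDatumExists` (existence of Fontaine's `(B_dR, WD ∘ D_pst)` datum with its
characterising clauses, in particular (F12) `crystallineDetOnInertia`), the crux `EmptyWeightCore` of route
`NonParallelVoid` holds — by the determinant-parity emptiness of its regime
(`NonParallelVoidEmptyWeightCore.emptyWeightCore_of_pinnedCrystallineDetLocal` fed with
`stub_pinnedCrystallineDetLocal_of_fontaineDatumExists`).  CONDITIONAL RESULT: the hypothesis is an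
existing unproved Literature named fact; the crux by name is `FontaineDatumExists → EmptyWeightCore`.
[cite: BrinonConrad2009, Prop. 8.3.4 and Prop. 9.1.11] [cite: SerreInventiones1972, §1.8 Prop. 6 and Prop. 8] -/
theorem EmptyWeightCore_of_fontaineDatumExists (hFD : FontaineDatumExists) :
    Summit.Langlands.Langlands.Theses.NonParallelVoid.EmptyWeightCore :=
  NonParallelVoidEmptyWeightCore.emptyWeightCore_of_pinnedCrystallineDetLocal
    (Summit.Langlands.Langlands.Cruxes.EmptyWeightCore.LocalClauseCut.stub_pinnedCrystallineDetLocal_of_fontaineDatumExists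
      hFD)

end Summit.Langlands.Langlands.Theorems

end
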